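import Literature.Analysis.FluidPDE.EulerSymGradientSlice
import Literature.Analysis.FunctionSpaces.TimeDoubling
import HarnessLib

/-!
# Weak Euler solutions with `∇v + ∇vᵀ ∈ L¹(0,T; L^∞)`: absolute continuity in `L²_σ` and
conservation of energy

Analysis/FluidPDE support file (serves the discharge of the barrier fact
`Literature.Barriers.AnomalousDissipation.BrenierDeLellisSzekelyhidi2011_cor1`, Brenier–De Lellis–
Székelyhidi 2011, Thm. 2 / Cor. 1). Standing data: a weak (pressure-free) solution `v` of the
unforced Euler equations on `E × [0,T)` with datum `v₀` (accepted `IsWeakNSSolutionOn T 0 0 v₀ v`),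
continuous into `L²` on `[0,T]`, with a jointly measurable weak-gradient witness `G t` for a.e. `t`
whose symmetric part `S t = G t + (G t)ᵀ` satisfies the printed condition (8),
`∫₀ᵀ ‖S t‖_{L^∞} dt < ∞`.

## Main results

* `euler_ae_good_time`: for a.e. `t ∈ (0,T)` the slice `v t` is `L²`, weakly divergence free,
  has the weak gradient `G t`, and `‖S t‖ ≤ ‖S t‖_{L^∞} < ∞` a.e.
* `euler_integral_inner_eq_sub_setIntegral` (**absolute continuity in `L²_σ`**): for every
  `L²`, weakly divergence-free `Φ` and every `s ∈ [0,T]`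
  `⟨v(s), Φ⟩ = ⟨v₀, Φ⟩ - ∫_{(0,s]} ⟨S v, Φ⟩ dτ`,
  i.e. `∂ₜ v = -P(S v) ∈ L¹(0,T; L²)` weakly; from the time-sliced weak formulation
  (`IsWeakNSSolutionOn.inner_test_eq_of_continuousInLpOn`), the flux identity
  `∫⟪v,(v·∇)Φ⟫ = -∫⟪S v, Φ⟫` (`EulerSymmetricGradient`) and the density of `𝒱` in `L²_σ`.
  In particular `⟨v(0), Φ⟩ = ⟨v₀, Φ⟩` (`euler_integral_inner_zero_eq`).
* `euler_integral_norm_sq_eq` (**conservation of energy**, "`∫ |v|²(x,t) dx` is constant",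
  Brenier–De Lellis–Székelyhidi 2011, proof of Thm. 2, p. 6 of arXiv:0912.1028): for every
  `t ∈ (0,T]`, `∫ ‖v t‖² = ∫ ‖v₀‖²`; by Serrin's doubling of the time variable
  (`FunctionSpaces.doubling_identity`) applied to `Q(s,σ) = ⟨v(s), v(σ)⟩`, both one-sided
  representations being the absolute continuity above, and the bulk terms vanishing by
  `∫ ⟪S v, v⟫ = 0` (`integral_inner_symGrad_apply_self_eq_zero`).

## Design

No structure is introduced (the file stays a pure-proof file); the standing hypotheses are
threaded explicitly. Jointly measurable, everywhere-`L²`-bounded versions of the fields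
(`exists_version_of_eLpNorm_le`) feed the time-mollification lemmas, exactly as in the tree's
`NSSerrinUniqueness`.

## References

* Y. Brenier, C. De Lellis, L. Székelyhidi Jr., *Weak-strong uniqueness for measure-valued
  solutions*, Comm. Math. Phys. 305 (2011), §3.1, Thm. 2 with (8) and its proof.
  [BrenierDeLellisSzekelyhidi2011]
* J. Serrin, *The initial value problem for the Navier–Stokes equations* (1963), §4 (doubling of
  the time variable). [Serrin1963]
-/

noncomputable section

open MeasureTheory TopologicalSpace Set Function Filter ContinuousLinearMap
open scoped ENNReal NNReal Convolution InnerProductSpace RealInnerProductSpace Topology Laplacian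

namespace Literature.Analysis.FluidPDE

variable {E : Type*} [NormedAddCommGroup E] [InnerProductSpace ℝ E] [FiniteDimensional ℝ E]
  [MeasurableSpace E] [BorelSpace E] [CompleteSpace E]

/-! ### Versions and slices -/

section Versions

variable {X : Type*} [MeasurableSpace X] {μ : Measure X} [SFinite μ]
variable {V : Type*} [NormedAddCommGroup V] [NormedSpace ℝ V]

omit [NormedAddCommGroup E] [InnerProductSpace ℝ E] [FiniteDimensional ℝ E] [MeasurableSpace E]
  [BorelSpace E] [CompleteSpace E] [NormedAddCommGroup V] [NormedSpace ℝ V] in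
/-- The slices of a jointly measurable version agree with the slices of the field a.e., for
a.e. time. [folklore] -/
theorem ae_slice_ae_eq_of_uncurry_ae_eq {T : ℝ} {u : ℝ → X → V} {ut : ℝ × X → V}
    (h : uncurry u =ᵐ[(volume.restrict (Ioo 0 T)).prod μ] ut) :
    ∀ᵐ s ∂(volume.restrict (Ioo 0 T)), u s =ᵐ[μ] fun x => ut (s, x) := by
  filter_upwards [Measure.ae_ae_of_ae_prod h] with s hs
  filter_upwards [hs] with x hx
  exact hx

omit [NormedAddCommGroup E] [InnerProductSpace ℝ E] [FiniteDimensional ℝ E] [MeasurableSpace E]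
  [BorelSpace E] [CompleteSpace E] [NormedSpace ℝ V] in
/-- **Jointly measurable, everywhere `L²`-bounded versions.** If `u` is a.e.-strongly measurable
on `(0,T) × X` and `‖u(s)‖_{L²} ≤ R` for a.e. `s ∈ (0,T)`, then there is a jointly strongly
measurable `ut` with `‖ut(s)‖_{L²} ≤ R` for **all** `s` and `ut(s) = u(s)` a.e. for a.e.
`s ∈ (0,T)` (take a measurable version and kill the slices violating the bound). [folklore] -/
theorem exists_version_of_eLpNorm_le {T : ℝ} {u : ℝ → X → V}
    (hu : AEStronglyMeasurable (uncurry u) ((volume.restrict (Ioo 0 T)).prod μ)) {R : ℝ≥0}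
    (hR : ∀ᵐ s ∂(volume.restrict (Ioo 0 T)), eLpNorm (u s) 2 μ ≤ R) :
    ∃ ut : ℝ → X → V, StronglyMeasurable (uncurry ut) ∧ (∀ s, eLpNorm (ut s) 2 μ ≤ R) ∧
      ∀ᵐ s ∂(volume.restrict (Ioo 0 T)), ut s =ᵐ[μ] u s := by
  set U : ℝ × X → V := hu.mk (uncurry u) with hU
  have hUm : StronglyMeasurable U := hu.stronglyMeasurable_mk
  have hslice : ∀ᵐ s ∂(volume.restrict (Ioo 0 T)), u s =ᵐ[μ] fun x => U (s, x) :=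
    ae_slice_ae_eq_of_uncurry_ae_eq hu.ae_eq_mk
  have hUc : StronglyMeasurable (uncurry fun s x => U (s, x)) := hUm
  set good : Set ℝ := {s | eLpNorm (fun x => U (s, x)) 2 μ ≤ R} with hgood
  have hgoodm : MeasurableSet good :=
    measurableSet_le (FunctionSpaces.measurable_eLpNorm_slice hUc 2) measurable_const
  set ut : ℝ → X → V := fun s x => good.indicator (fun s => U (s, x)) s with hut
  have hut_mem : ∀ {s}, s ∈ good → ut s = fun x => U (s, x) := fun hs => by
    ext x; simp only [hut, indicator_of_mem hs]
  have hut_nmem : ∀ {s}, s ∉ good → ut s = 0 := fun hs => by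
    ext x; simp only [hut, indicator_of_notMem hs, Pi.zero_apply]
  refine ⟨ut, ?_, fun s => ?_, ?_⟩
  · have : uncurry ut = {z : ℝ × X | z.1 ∈ good}.indicator U := by
      ext z; simp only [hut, uncurry, indicator_apply, mem_setOf_eq]
    rw [this]
    exact hUm.indicator (hgoodm.preimage measurable_fst)
  · by_cases hs : s ∈ good
    · rw [hut_mem hs]; exact hs
    · rw [hut_nmem hs, eLpNorm_zero]; exact zero_le
  · filter_upwards [hslice, hR] with s hs hsR
    have hs' : s ∈ good := by
      change eLpNorm (fun x => U (s, x)) 2 μ ≤ R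
      rwa [← eLpNorm_congr_ae hs]
    rw [hut_mem hs']
    exact hs.symm

end Versions

/-! ### Standing consequences of condition (8) -/

section Euler

variable {T : ℝ} {v₀ : E → E} {v : ℝ → E → E} {G : ℝ → E → E →L[ℝ] E}

omit [FiniteDimensional ℝ E] [MeasurableSpace E] [BorelSpace E] in
/-- The symmetric part of a jointly measurable operator field is jointly measurable. [folklore] -/
theorem stronglyMeasurable_uncurry_symGrad [MeasurableSpace E] (hGm : StronglyMeasurable (uncurry G)) :
    StronglyMeasurable (uncurry fun t x => G t x + adjoint (G t x)) :=
  hGm.add ((adjoint : (E →L[ℝ] E) ≃ₗᵢ⋆[ℝ] (E →L[ℝ] E)).continuous.comp_stronglyMeasurable hGm)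

/-- **Good times.** Under condition (8) with a jointly measurable gradient witness, for a.e.
`t ∈ (0,T)`: `v t` is weakly divergence free, `G t` is its weak gradient, `‖S t‖_{L^∞} < ∞` and
`‖S t x‖ ≤ ‖S t‖_{L^∞}` for a.e. `x` (`S t = G t + (G t)ᵀ`). [folklore] -/
theorem euler_ae_good_time (hv : IsWeakNSSolutionOn T 0 0 v₀ v)
    (hG : ∀ᵐ t ∂(volume.restrict (Ioo 0 T)), HasWeakGradient (v t) (G t))
    (hGm : StronglyMeasurable (uncurry G))
    (hS : ∫⁻ t in Ioo 0 T, eLpNorm (fun x => G t x + adjoint (G t x)) ∞ volume < ∞) :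
    ∀ᵐ t ∂(volume.restrict (Ioo 0 T)), t ∈ Ioo 0 T ∧ IsWeaklyDivFree (v t) ∧
      HasWeakGradient (v t) (G t) ∧ eLpNorm (fun x => G t x + adjoint (G t x)) ∞ volume < ∞ ∧
      ∀ᵐ x ∂(volume : Measure E), ‖G t x + adjoint (G t x)‖ ≤
        (eLpNorm (fun x => G t x + adjoint (G t x)) ∞ volume).toReal := by
  have hcm : Measurable fun t => eLpNorm (fun x => G t x + adjoint (G t x)) ∞ volume :=
    FunctionSpaces.measurable_eLpNorm_slice (stronglyMeasurable_uncurry_symGrad hGm) ∞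
  have hfin : ∀ᵐ t ∂(volume.restrict (Ioo 0 T)),
      eLpNorm (fun x => G t x + adjoint (G t x)) ∞ volume < ∞ := ae_lt_top hcm hS.ne
  filter_upwards [ae_restrict_mem measurableSet_Ioo, hv.2.2.1, hG, hfin] with t ht hdiv hGt hct
  refine ⟨ht, hdiv, hGt, hct, ?_⟩
  filter_upwards [ae_le_eLpNormEssSup (f := fun x => G t x + adjoint (G t x))
    (μ := (volume : Measure E))] with x hx
  rw [← eLpNorm_exponent_top] at hx
  rw [← toReal_enorm]
  exact ENNReal.toReal_mono hct.ne hx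

/-- **`S v` has integrable `L²` norm in time**: `∫_{(0,T)} ‖S t (v t)‖_{L²} dt ≤ R ∫_{(0,T)} ‖S t‖_∞`
when `‖v t‖_{L²} ≤ R` on `[0,T]`. [folklore] -/
theorem euler_eLpNorm_symGrad_apply_le (hv : IsWeakNSSolutionOn T 0 0 v₀ v)
    (hG : ∀ᵐ t ∂(volume.restrict (Ioo 0 T)), HasWeakGradient (v t) (G t))
    (hGm : StronglyMeasurable (uncurry G))
    (hS : ∫⁻ t in Ioo 0 T, eLpNorm (fun x => G t x + adjoint (G t x)) ∞ volume < ∞)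
    {R : ℝ≥0} (hR : ∀ t ∈ Icc 0 T, eLpNorm (v t) 2 volume ≤ R) :
    ∀ᵐ t ∂(volume.restrict (Ioo 0 T)),
      eLpNorm (fun x => (G t x + adjoint (G t x)) (v t x)) 2 volume ≤
        eLpNorm (fun x => G t x + adjoint (G t x)) ∞ volume * R := by
  filter_upwards [euler_ae_good_time hv hG hGm hS] with t ht
  obtain ⟨htI, -, -, hct, hae⟩ := ht
  set c : ℝ≥0∞ := eLpNorm (fun x => G t x + adjoint (G t x)) ∞ volume with hc
  have h1 := eLpNorm_clm_apply_le (b := v t) (M := c.toNNReal)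
    (by simpa only [ENNReal.coe_toNNReal_eq_toReal] using hae) 2
  rw [ENNReal.smul_def, smul_eq_mul, ENNReal.coe_toNNReal hct.ne] at h1
  exact h1.trans (mul_le_mul_right (hR t (Ioo_subset_Icc_self htI)) _)

omit [CompleteSpace E] in
/-- **Uniform `L²` bound in `ℝ≥0∞` form** for a field continuous into `L²` on `[0,T]`. [folklore] -/
theorem ContinuousInLpOn.exists_eLpNorm_le_of_Icc (hc : ContinuousInLpOn (Icc 0 T) 2 v) :
    ∃ R : ℝ≥0, ∀ s ∈ Icc 0 T, eLpNorm (v s) 2 volume ≤ R := by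
  obtain ⟨R, -, hR⟩ := hc.exists_toReal_eLpNorm_le_of_Icc
  refine ⟨R.toNNReal, fun s hs => ?_⟩
  rw [← ENNReal.ofReal_toReal (hc.1 s hs).eLpNorm_ne_top]
  exact ENNReal.ofReal_le_ofReal (hR s hs)

/-- **The pairing `τ ↦ ⟨S τ (v τ), w⟩` is integrable on `(0,T)`** for every `w ∈ L²`, and
`|∫_{(0,s]} ⟨S v, w⟩| ≤ ‖w‖_{L²} (R ∫ ‖S‖_∞)` where `‖v τ‖_{L²} ≤ R` on `[0,T]`. [folklore] -/
theorem euler_integrableOn_integral_inner_symGrad_apply (hv : IsWeakNSSolutionOn T 0 0 v₀ v)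
    (hc : ContinuousInLpOn (Icc 0 T) 2 v)
    (hG : ∀ᵐ t ∂(volume.restrict (Ioo 0 T)), HasWeakGradient (v t) (G t))
    (hGm : StronglyMeasurable (uncurry G))
    (hS : ∫⁻ t in Ioo 0 T, eLpNorm (fun x => G t x + adjoint (G t x)) ∞ volume < ∞)
    {R : ℝ≥0} (hR : ∀ t ∈ Icc 0 T, eLpNorm (v t) 2 volume ≤ R) {w : E → E}
    (hw : MemLp w 2 volume) :
    IntegrableOn (fun τ => ∫ x, ⟪(G τ x + adjoint (G τ x)) (v τ x), w x⟫) (Ioo 0 T) ∧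
      ∀ s ∈ Icc 0 T, |∫ τ in Ioc 0 s, ∫ x, ⟪(G τ x + adjoint (G τ x)) (v τ x), w x⟫| ≤
        (eLpNorm w 2 volume).toReal *
          ((∫⁻ t in Ioo 0 T, eLpNorm (fun x => G t x + adjoint (G t x)) ∞ volume) * R).toReal := by
  set S : ℝ → E → E →L[ℝ] E := fun t x => G t x + adjoint (G t x) with hSdef
  set c : ℝ → ℝ≥0∞ := fun t => eLpNorm (S t) ∞ volume with hcdef
  set μT : Measure ℝ := volume.restrict (Ioo 0 T) with hμT
  have hSm : StronglyMeasurable (uncurry S) := stronglyMeasurable_uncurry_symGrad hGm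
  have hcm : Measurable c := FunctionSpaces.measurable_eLpNorm_slice hSm ∞
  have hcint : ∫⁻ t, c t ∂μT < ∞ := hS
  -- measurability of the pairing in time
  have hvm : AEStronglyMeasurable (uncurry v) (μT.prod (volume : Measure E)) := by
    rw [hμT, restrict_prod_volume_eq]; exact hv.1
  have hAm : AEStronglyMeasurable (fun p : ℝ × E => S p.1 p.2 (uncurry v p))
      (μT.prod (volume : Measure E)) :=
    aestronglyMeasurable_clm_apply hSm.aestronglyMeasurable hvm
  have hmeas : AEStronglyMeasurable (fun τ => ∫ x, ⟪S τ x (v τ x), w x⟫) μT := by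
    have h1 : AEStronglyMeasurable (fun p : ℝ × E => ⟪S p.1 p.2 (uncurry v p), w p.2⟫)
        (μT.prod (volume : Measure E)) := hAm.inner hw.1.comp_snd
    exact h1.integral_prod_right'
  -- slice bound
  have hsl := euler_eLpNorm_symGrad_apply_le hv hG hGm hS hR
  have hbound : ∀ᵐ τ ∂μT, ‖∫ x, ⟪S τ x (v τ x), w x⟫‖ ≤
      (c τ * R).toReal * (eLpNorm w 2 volume).toReal := by
    filter_upwards [hsl, euler_ae_good_time hv hG hGm hS] with τ hτ hgood
    obtain ⟨hτI, -, -, hct, -⟩ := hgood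
    have hvτ : MemLp (v τ) 2 volume := hc.1 τ (Ioo_subset_Icc_self hτI)
    have hfin : c τ * R ≠ ⊤ := ENNReal.mul_ne_top hct.ne ENNReal.coe_ne_top
    have hAτ : AEStronglyMeasurable (fun x => S τ x (v τ x)) volume :=
      aestronglyMeasurable_clm_apply (hSm.of_uncurry_left (x := τ)).aestronglyMeasurable hvτ.1
    have h1 := FunctionSpaces.enorm_integral_inner_le_eLpNorm_mul hAτ hw.1
    have h2 : ‖∫ x, ⟪S τ x (v τ x), w x⟫‖ₑ ≤ (c τ * R) * eLpNorm w 2 volume :=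
      h1.trans (mul_le_mul_left hτ _)
    rw [← toReal_enorm, ← ENNReal.toReal_mul]
    exact ENNReal.toReal_mono (ENNReal.mul_ne_top hfin hw.eLpNorm_ne_top) h2
  -- integrability
  have hmaj : Integrable (fun τ => (c τ * R).toReal * (eLpNorm w 2 volume).toReal) μT := by
    refine (Integrable.mul_const ?_ _)
    have : (fun τ => (c τ * R).toReal) = fun τ => (c τ).toReal * (R : ℝ) := by
      ext τ; rw [ENNReal.toReal_mul, ENNReal.coe_toReal]
    rw [this]
    exact (integrable_toReal_of_lintegral_ne_top hcm.aemeasurable hcint.ne).mul_const _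
  have hint : IntegrableOn (fun τ => ∫ x, ⟪S τ x (v τ x), w x⟫) (Ioo 0 T) :=
    hmaj.mono' hmeas hbound
  refine ⟨hint, fun s hs => ?_⟩
  -- the bound on `(0, s]`, `s ≤ T`: reduce to `(0, T)`
  have hcfin : ∀ᵐ τ ∂μT, c τ < ⊤ := ae_lt_top hcm hcint.ne
  have hsub : Ioo 0 s ⊆ Ioo 0 T := Ioo_subset_Ioo le_rfl hs.2
  have hle : |∫ τ in Ioc 0 s, ∫ x, ⟪S τ x (v τ x), w x⟫| ≤
      ∫ τ in Ioo 0 T, (c τ * R).toReal * (eLpNorm w 2 volume).toReal := by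
    rw [← Real.norm_eq_abs, ← setIntegral_congr_set (Ioo_ae_eq_Ioc (μ := (volume : Measure ℝ))
      (a := (0 : ℝ)) (b := s))]
    have hint' : IntegrableOn (fun τ => ∫ x, ⟪S τ x (v τ x), w x⟫) (Ioo 0 s) := hint.mono_set hsub
    have hbound' : ∀ᵐ τ ∂(volume.restrict (Ioo 0 s)), ‖∫ x, ⟪S τ x (v τ x), w x⟫‖ ≤
        (c τ * R).toReal * (eLpNorm w 2 volume).toReal :=
      ae_restrict_of_ae_restrict_of_subset hsub hbound
    calc ‖∫ τ in Ioo 0 s, ∫ x, ⟪S τ x (v τ x), w x⟫‖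
        ≤ ∫ τ in Ioo 0 s, (c τ * R).toReal * (eLpNorm w 2 volume).toReal :=
          norm_integral_le_of_norm_le (hmaj.mono_measure (Measure.restrict_mono hsub le_rfl))
            hbound'
      _ ≤ ∫ τ in Ioo 0 T, (c τ * R).toReal * (eLpNorm w 2 volume).toReal :=
          setIntegral_mono_set hmaj (ae_of_all _ fun τ => by positivity) hsub.eventuallyLE
  refine hle.trans (le_of_eq ?_)
  rw [integral_mul_const, mul_comm]
  congr 1
  rw [← lintegral_mul_const _ hcm]
  exact integral_toReal (hcm.mul_const _).aemeasurable
    (by filter_upwards [hcfin] with τ hτ; exact ENNReal.mul_lt_top hτ ENNReal.coe_lt_top)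

/-- **Absolute continuity in `L²_σ` of a weak Euler solution with `∇v + ∇vᵀ ∈ L¹(L^∞)`.** For
every `Φ ∈ L²(E;E)` weakly divergence free and every `s ∈ [0, T]`
`⟨v(s), Φ⟩ = ⟨v₀, Φ⟩ - ∫_{(0,s]} ∫ ⟪(G + Gᵀ) v, Φ⟫ dx dτ`
(Brenier–De Lellis–Székelyhidi 2011, Thm. 2 setting: this is the weak form of
`∂ₜ v + P((∇v + ∇vᵀ) v) = 0`, valid since `(v·∇)v = (∇v + ∇vᵀ)v - ∇(½|v|²)`). Proof: for
`Φ ∈ 𝒱` combine the time-sliced weak formulation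
(`IsWeakNSSolutionOn.inner_test_eq_of_continuousInLpOn`) with the flux identity
(`integral_inner_fderiv_apply_self_eq_neg_integral_inner_symGrad`) at a.e. time; then pass to
`L²` limits of such `Φ` (`exists_divFreeTest_tendsto_eLpNorm`), every term being `L²`-continuous
in `Φ`. [cite: BrenierDeLellisSzekelyhidi2011, §3.1 Thm. 2 with (8)] -/
theorem euler_integral_inner_eq_sub_setIntegral (hT : 0 < T) (hv : IsWeakNSSolutionOn T 0 0 v₀ v)
    (hc : ContinuousInLpOn (Icc 0 T) 2 v) (hv₀ : MemLp v₀ 2 volume)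
    (hG : ∀ᵐ t ∂(volume.restrict (Ioo 0 T)), HasWeakGradient (v t) (G t))
    (hGm : StronglyMeasurable (uncurry G))
    (hS : ∫⁻ t in Ioo 0 T, eLpNorm (fun x => G t x + adjoint (G t x)) ∞ volume < ∞)
    {Φ : E → E} (hΦ : MemLp Φ 2 volume) (hΦdiv : IsWeaklyDivFree Φ) {s : ℝ} (hs : s ∈ Icc 0 T) :
    ∫ x, ⟪v s x, Φ x⟫ = (∫ x, ⟪v₀ x, Φ x⟫) -
      ∫ τ in Ioc 0 s, ∫ x, ⟪(G τ x + adjoint (G τ x)) (v τ x), Φ x⟫ := by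
  set S : ℝ → E → E →L[ℝ] E := fun t x => G t x + adjoint (G t x) with hSdef
  obtain ⟨R, hR⟩ := hc.exists_eLpNorm_le_of_Icc
  have hgood := euler_ae_good_time hv hG hGm hS
  -- ### the identity for smooth compactly supported divergence-free `Ψ`
  have hV : ∀ {Ψ : E → E}, Ψ ∈ divFreeTest E → ∫ x, ⟪v s x, Ψ x⟫ = (∫ x, ⟪v₀ x, Ψ x⟫) -
      ∫ τ in Ioc 0 s, ∫ x, ⟪S τ x (v τ x), Ψ x⟫ := by
    intro Ψ hΨ
    have h1 := hv.inner_test_eq_of_continuousInLpOn hc hT hΨ.1 hΨ.2 hs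
    rw [h1, sub_eq_add_neg, ← integral_neg]
    congr 1
    -- slice-wise: `∫ (⟪v, (v·∇)Ψ⟫ + 0) = -∫ ⟪S v, Ψ⟫` for a.e. `τ ∈ (0, s]`
    rw [← restrict_Ioo_eq_restrict_Ioc]
    refine integral_congr_ae ?_
    have hsub : Ioo 0 s ⊆ Ioo 0 T := Ioo_subset_Ioo le_rfl hs.2
    filter_upwards [ae_restrict_of_ae_restrict_of_subset hsub hgood] with τ hτ
    obtain ⟨hτI, hdivτ, hGτ, -, haeτ⟩ := hτ
    have hvτ : MemLp (v τ) 2 volume := hc.1 τ (Ioo_subset_Icc_self hτI)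
    have h2 := integral_inner_fderiv_apply_self_eq_neg_integral_inner_symGrad hvτ hdivτ hGτ haeτ
      hΨ.1 hΨ.2
    simp only [zero_mul, add_zero, convect_apply]
    exact h2
  -- ### approximation of `Φ`
  obtain ⟨ψ, hψ, hψlim⟩ := exists_divFreeTest_tendsto_eLpNorm hΦ hΦdiv
  have hψ2 : ∀ j, MemLp (ψ j) 2 volume := fun j => memLp_of_mem_divFreeTest (hψ j) 2
  have hvs : MemLp (v s) 2 volume := hc.1 s hs
  have hL : Tendsto (fun j => ∫ x, ⟪v s x, ψ j x⟫) atTop (𝓝 (∫ x, ⟪v s x, Φ x⟫)) :=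
    tendsto_integral_inner_right_of_tendsto_eLpNorm hvs (Eventually.of_forall hψ2) hΦ hψlim
  have hL0 : Tendsto (fun j => ∫ x, ⟪v₀ x, ψ j x⟫) atTop (𝓝 (∫ x, ⟪v₀ x, Φ x⟫)) :=
    tendsto_integral_inner_right_of_tendsto_eLpNorm hv₀ (Eventually.of_forall hψ2) hΦ hψlim
  -- the time integrals
  have hflux : Tendsto (fun j => ∫ τ in Ioc 0 s, ∫ x, ⟪S τ x (v τ x), ψ j x⟫) atTop
      (𝓝 (∫ τ in Ioc 0 s, ∫ x, ⟪S τ x (v τ x), Φ x⟫)) := by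
    obtain ⟨iΦ, -⟩ := euler_integrableOn_integral_inner_symGrad_apply hv hc hG hGm hS hR hΦ
    have hsub : Ioo 0 s ⊆ Ioo 0 T := Ioo_subset_Ioo le_rfl hs.2
    set K : ℝ := ((∫⁻ t in Ioo 0 T, eLpNorm (S t) ∞ volume) * R).toReal with hK
    have hbound : ∀ j, |(∫ τ in Ioc 0 s, ∫ x, ⟪S τ x (v τ x), ψ j x⟫) -
        ∫ τ in Ioc 0 s, ∫ x, ⟪S τ x (v τ x), Φ x⟫| ≤ (eLpNorm (ψ j - Φ) 2 volume).toReal * K := by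
      intro j
      obtain ⟨iψ, -⟩ := euler_integrableOn_integral_inner_symGrad_apply hv hc hG hGm hS hR (hψ2 j)
      obtain ⟨iD, bD⟩ := euler_integrableOn_integral_inner_symGrad_apply hv hc hG hGm hS hR
        ((hψ2 j).sub hΦ)
      have iψ' : IntegrableOn (fun τ => ∫ x, ⟪S τ x (v τ x), ψ j x⟫) (Ioc 0 s) := by
        rw [integrableOn_Ioc_iff_integrableOn_Ioo]; exact iψ.mono_set hsub
      have iΦ' : IntegrableOn (fun τ => ∫ x, ⟪S τ x (v τ x), Φ x⟫) (Ioc 0 s) := by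
        rw [integrableOn_Ioc_iff_integrableOn_Ioo]; exact iΦ.mono_set hsub
      rw [← integral_sub iψ' iΦ']
      refine le_trans (le_of_eq ?_) (bD s hs)
      congr 1
      rw [← restrict_Ioo_eq_restrict_Ioc]
      refine integral_congr_ae ?_
      filter_upwards [ae_restrict_of_ae_restrict_of_subset hsub hgood,
        ae_restrict_of_ae_restrict_of_subset hsub (euler_eLpNorm_symGrad_apply_le hv hG hGm hS hR)]
        with τ hτ hτ2
      obtain ⟨hτI, -, -, hct, haeτ⟩ := hτ
      have hvτ : MemLp (v τ) 2 volume := hc.1 τ (Ioo_subset_Icc_self hτI)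
      have hSvτ : MemLp (fun x => S τ x (v τ x)) 2 volume :=
        ⟨aestronglyMeasurable_clm_apply
          ((stronglyMeasurable_uncurry_symGrad hGm).of_uncurry_left (x := τ)).aestronglyMeasurable
          hvτ.1, hτ2.trans_lt (ENNReal.mul_lt_top hct ENNReal.coe_lt_top)⟩
      rw [← integral_sub (integrable_inner_of_memLp_two hSvτ (hψ2 j))
        (integrable_inner_of_memLp_two hSvτ hΦ)]
      refine integral_congr_ae (ae_of_all _ fun x => ?_)
      dsimp only
      rw [Pi.sub_apply, inner_sub_right]
    have hδ : Tendsto (fun j => (eLpNorm (ψ j - Φ) 2 volume).toReal * K) atTop (𝓝 0) := by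
      have h1 : Tendsto (fun j => (eLpNorm (ψ j - Φ) 2 volume).toReal) atTop (𝓝 0) := by
        rw [← ENNReal.toReal_zero]
        exact (ENNReal.tendsto_toReal ENNReal.zero_ne_top).comp hψlim
      simpa using h1.mul_const K
    rw [Metric.tendsto_atTop]
    intro ε hε
    obtain ⟨N, hN⟩ := Metric.tendsto_atTop.1 hδ ε hε
    refine ⟨N, fun j hj => ?_⟩
    have h1 := hN j hj
    rw [Real.dist_eq, sub_zero] at h1
    rw [Real.dist_eq]
    exact (hbound j).trans_lt (lt_of_abs_lt h1)
  -- ### conclusion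
  have hlim := hL0.sub hflux
  have heq : (fun j => ∫ x, ⟪v s x, ψ j x⟫) =
      fun j => (∫ x, ⟪v₀ x, ψ j x⟫) - ∫ τ in Ioc 0 s, ∫ x, ⟪S τ x (v τ x), ψ j x⟫ :=
    funext fun j => hV (hψ j)
  rw [← heq] at hlim
  exact tendsto_nhds_unique hL hlim

/-- **The initial value in `L²_σ`**: `⟨v(0), Φ⟩ = ⟨v₀, Φ⟩` for every `L²`, weakly divergence-free
`Φ` (`euler_integral_inner_eq_sub_setIntegral` at `s = 0`). [folklore] -/
theorem euler_integral_inner_zero_eq (hT : 0 < T) (hv : IsWeakNSSolutionOn T 0 0 v₀ v)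
    (hc : ContinuousInLpOn (Icc 0 T) 2 v) (hv₀ : MemLp v₀ 2 volume)
    (hG : ∀ᵐ t ∂(volume.restrict (Ioo 0 T)), HasWeakGradient (v t) (G t))
    (hGm : StronglyMeasurable (uncurry G))
    (hS : ∫⁻ t in Ioo 0 T, eLpNorm (fun x => G t x + adjoint (G t x)) ∞ volume < ∞)
    {Φ : E → E} (hΦ : MemLp Φ 2 volume) (hΦdiv : IsWeaklyDivFree Φ) :
    ∫ x, ⟪v 0 x, Φ x⟫ = ∫ x, ⟪v₀ x, Φ x⟫ := by
  have h := euler_integral_inner_eq_sub_setIntegral hT hv hc hv₀ hG hGm hS hΦ hΦdiv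
    (left_mem_Icc.2 hT.le)
  simpa using h

end Euler

/-! ### Swapping the time variables in kernel-weighted pairings -/

section Swap

variable {X : Type*} [MeasurableSpace X] {μ : Measure X} [SFinite μ]
variable {V : Type*} [NormedAddCommGroup V] [InnerProductSpace ℝ V] [CompleteSpace V]

omit [NormedAddCommGroup E] [InnerProductSpace ℝ E] [FiniteDimensional ℝ E] [MeasurableSpace E]
  [BorelSpace E] [CompleteSpace E] in
/-- Swapping the two time variables in a kernel-weighted pairing with an even kernel:
`∫∫ ρ(s-σ) F(σ,s) = ∫∫ ρ(s-σ) F(s,σ)` on `(0,t)²`. [folklore] -/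
theorem integral_normed_mul_swap (φ : ContDiffBump (0 : ℝ)) {t : ℝ} (F : ℝ → ℝ → ℝ) :
    ∫ p, φ.normed volume (p.2 - p.1) * F p.1 p.2
        ∂((volume.restrict (Ioo 0 t)).prod (volume.restrict (Ioo 0 t))) =
      ∫ p, φ.normed volume (p.2 - p.1) * F p.2 p.1
        ∂((volume.restrict (Ioo 0 t)).prod (volume.restrict (Ioo 0 t))) := by
  rw [← integral_prod_swap]
  refine integral_congr_ae (ae_of_all _ fun p => ?_)
  simp only [Prod.fst_swap, Prod.snd_swap]
  rw [FunctionSpaces.normed_sub_comm φ p.1 p.2]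

omit [NormedAddCommGroup E] [InnerProductSpace ℝ E] [FiniteDimensional ℝ E] [MeasurableSpace E]
  [BorelSpace E] [CompleteSpace E] in
/-- Swapping the two time variables preserves integrability of a kernel-weighted pairing with
an even kernel. [folklore] -/
theorem integrable_normed_mul_swap_iff (φ : ContDiffBump (0 : ℝ)) {t : ℝ} (F : ℝ → ℝ → ℝ) :
    Integrable (fun p : ℝ × ℝ => φ.normed volume (p.2 - p.1) * F p.1 p.2)
        ((volume.restrict (Ioo 0 t)).prod (volume.restrict (Ioo 0 t))) ↔
      Integrable (fun p : ℝ × ℝ => φ.normed volume (p.2 - p.1) * F p.2 p.1)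
        ((volume.restrict (Ioo 0 t)).prod (volume.restrict (Ioo 0 t))) := by
  have h : (fun p : ℝ × ℝ => φ.normed volume (p.2 - p.1) * F p.2 p.1) =
      (fun p : ℝ × ℝ => φ.normed volume (p.2 - p.1) * F p.1 p.2) ∘ Prod.swap := by
    ext p
    simp only [Function.comp_apply, Prod.fst_swap, Prod.snd_swap]
    rw [FunctionSpaces.normed_sub_comm φ p.1 p.2]
  rw [h, integrable_swap_iff]

omit [NormedAddCommGroup E] [InnerProductSpace ℝ E] [FiniteDimensional ℝ E] [MeasurableSpace E]
  [BorelSpace E] [CompleteSpace E] in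
/-- **Swapped `L¹ₜL²ₓ – L^∞ₜL²ₓ` limit**: with the bounded factor in the first and the `L¹ₜ`
factor in the second time variable,
`∫∫_{(0,t)²} ρₙ(s - σ) ⟨Φ(σ), A(s)⟩ dσ ds → ∫_{(0,t)} ⟨Φ(s), A(s)⟩ ds`. [folklore] -/
theorem tendsto_integral_normed_mul_integral_inner_of_eLpNorm_le_swap
    {φ : ℕ → ContDiffBump (0 : ℝ)} (hφ : Tendsto (fun n => (φ n).rOut) atTop (𝓝 0)) {t : ℝ}
    {A Φ : ℝ → X → V} (hA : StronglyMeasurable (uncurry A)) (hΦ : StronglyMeasurable (uncurry Φ))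
    (hA1 : ∫⁻ s in Ioo 0 t, eLpNorm (A s) 2 μ < ∞) {R : ℝ≥0} (hΦR : ∀ s, eLpNorm (Φ s) 2 μ ≤ R) :
    Tendsto (fun n => ∫ p, (φ n).normed volume (p.2 - p.1) * ∫ x, ⟪Φ p.1 x, A p.2 x⟫ ∂μ
        ∂((volume.restrict (Ioo 0 t)).prod (volume.restrict (Ioo 0 t))))
      atTop (𝓝 (∫ z, ⟪Φ z.1 z.2, A z.1 z.2⟫ ∂((volume.restrict (Ioo 0 t)).prod μ))) := by
  have h := tendsto_integral_normed_mul_integral_inner_of_eLpNorm_le (μ := μ) hφ hA hΦ hA1 hΦR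
  refine h.congr fun n => ?_
  exact (integral_normed_mul_swap (φ n) fun a b => ∫ x, ⟪Φ b x, A a x⟫ ∂μ)

end Swap

/-! ### Conservation of energy -/

section Energy

variable {T : ℝ} {v₀ : E → E} {v : ℝ → E → E} {G : ℝ → E → E →L[ℝ] E}

omit [CompleteSpace E] in
/-- Symmetry of the real `L²` pairing (local copy of the tree's `integral_inner_comm`, whose
module is not imported here). [folklore] -/
private theorem integral_inner_comm_aux (f g : E → E) : ∫ x, ⟪f x, g x⟫ = ∫ x, ⟪g x, f x⟫ :=
  integral_congr_ae (ae_of_all _ fun _ => real_inner_comm _ _)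

/-- **Conservation of energy for weak Euler solutions with `∇v + ∇vᵀ ∈ L¹(0,T;L^∞)`**
(Brenier–De Lellis–Székelyhidi 2011, proof of Thm. 2: "`∫ |v|²(x,t) dx` is constant"): for every
`t ∈ (0, T]`, `∫ ⟪v t, v t⟫ = ∫ ⟪v₀, v₀⟫`. Proof: Serrin's doubling identity
(`FunctionSpaces.doubling_identity`) for `Q(s,σ) = ⟨v(s), v(σ)⟩`, both one-sided
representations being the absolute continuity `euler_integral_inner_eq_sub_setIntegral`
(densities `-⟨S τ v τ, v σ⟩`, resp. `-⟨S τ v τ, v s⟩`), with boundary data continuous by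
`v ∈ C([0,T];L²)` and `⟨v(0), v₀⟩ = ‖v₀‖²` (`euler_integral_inner_zero_eq`); the two bulk limits
are `-∫₀ᵗ ⟨S v, v⟩ = 0` (`integral_inner_symGrad_apply_self_eq_zero`,
`tendsto_integral_normed_mul_integral_inner_of_eLpNorm_le`). [cite: BrenierDeLellisSzekelyhidi2011, §3.1 proof of Thm. 2] -/
theorem euler_integral_inner_self_eq (hT : 0 < T) (hv : IsWeakNSSolutionOn T 0 0 v₀ v)
    (hc : ContinuousInLpOn (Icc 0 T) 2 v) (hv₀ : MemLp v₀ 2 volume)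
    (hv₀div : IsWeaklyDivFree v₀)
    (hG : ∀ᵐ t ∂(volume.restrict (Ioo 0 T)), HasWeakGradient (v t) (G t))
    (hGm : StronglyMeasurable (uncurry G))
    (hS : ∫⁻ t in Ioo 0 T, eLpNorm (fun x => G t x + adjoint (G t x)) ∞ volume < ∞)
    {t : ℝ} (ht : t ∈ Ioc 0 T) :
    ∫ x, ⟪v t x, v t x⟫ = ∫ x, ⟪v₀ x, v₀ x⟫ := by
  obtain ⟨φ, hφ, -⟩ := FunctionSpaces.exists_contDiffBump_seq (E := ℝ)
  set S : ℝ → E → E →L[ℝ] E := fun t x => G t x + adjoint (G t x) with hSdef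
  set νt : Measure ℝ := volume.restrict (Ioo 0 t) with hνt
  haveI : IsFiniteMeasure νt := by rw [hνt]; infer_instance
  have htT : Ioo (0 : ℝ) t ⊆ Ioo 0 T := Ioo_subset_Ioo le_rfl ht.2
  have hIoc : ∀ s ∈ Ioc 0 t, s ∈ Icc 0 T := fun s hs => ⟨hs.1.le, hs.2.trans ht.2⟩
  obtain ⟨R, hR⟩ := hc.exists_eLpNorm_le_of_Icc
  have hgood := euler_ae_good_time hv hG hGm hS
  have hSm : StronglyMeasurable (uncurry S) := stronglyMeasurable_uncurry_symGrad hGm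
  -- ### the data of the doubling identity
  set L₀ : ℝ := ∫ x, ⟪v₀ x, v₀ x⟫ with hL₀
  obtain ⟨Q, hQ⟩ : ∃ F : ℝ → ℝ → ℝ, F = fun s σ => ∫ x, ⟪v s x, v σ x⟫ := ⟨_, rfl⟩
  obtain ⟨c, hcdef⟩ : ∃ F : ℝ → ℝ, F = fun σ => ∫ x, ⟪v₀ x, v σ x⟫ := ⟨_, rfl⟩
  obtain ⟨f, hf⟩ : ∃ F : ℝ → ℝ → ℝ, F = fun σ τ => -∫ x, ⟪S τ x (v τ x), v σ x⟫ := ⟨_, rfl⟩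
  -- ### versions
  have hvm : AEStronglyMeasurable (uncurry v)
      (((volume : Measure ℝ).restrict (Ioo 0 T)).prod (volume : Measure E)) := by
    rw [restrict_prod_volume_eq]; exact hv.1
  have hRae : ∀ᵐ s ∂(volume.restrict (Ioo 0 T)), eLpNorm (v s) 2 volume ≤ R := by
    filter_upwards [ae_restrict_mem measurableSet_Ioo] with s hs
    exact hR s (Ioo_subset_Icc_self hs)
  obtain ⟨vt, hvtm, hvtR, hvt⟩ := exists_version_of_eLpNorm_le hvm hRae
  set A : ℝ → E → E := fun s x => S s x (vt s x) with hA
  have hAm : StronglyMeasurable (uncurry A) :=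
    (ContinuousLinearMap.id ℝ (E →L[ℝ] E)).continuous₂.comp_stronglyMeasurable
      (hSm.prodMk hvtm)
  -- slices of the versions (restricted to `(0, t)`)
  have hvt' : ∀ᵐ s ∂νt, vt s =ᵐ[volume] v s := ae_restrict_of_ae_restrict_of_subset htT hvt
  have hgood' : ∀ᵐ s ∂νt, s ∈ Ioo 0 T ∧ IsWeaklyDivFree (v s) ∧ HasWeakGradient (v s) (G s) ∧
      eLpNorm (S s) ∞ volume < ∞ ∧ ∀ᵐ x ∂(volume : Measure E), ‖S s x‖ ≤
        (eLpNorm (S s) ∞ volume).toReal := ae_restrict_of_ae_restrict_of_subset htT hgood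
  have hAt : ∀ᵐ s ∂νt, A s =ᵐ[volume] fun x => S s x (v s x) := by
    filter_upwards [hvt'] with s hs
    filter_upwards [hs] with x hx
    simp only [hA, hx]
  -- `A ∈ L¹ₜ L²ₓ`
  have hA1 : ∫⁻ s in Ioo 0 t, eLpNorm (A s) 2 volume < ∞ := by
    have hle : ∀ᵐ s ∂νt, eLpNorm (A s) 2 volume ≤ eLpNorm (S s) ∞ volume * R := by
      filter_upwards [hAt, ae_restrict_of_ae_restrict_of_subset htT
        (euler_eLpNorm_symGrad_apply_le hv hG hGm hS hR)] with s hs hs2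
      rw [eLpNorm_congr_ae hs]; exact hs2
    calc ∫⁻ s in Ioo 0 t, eLpNorm (A s) 2 volume ≤ ∫⁻ s in Ioo 0 t, eLpNorm (S s) ∞ volume * R :=
          lintegral_mono_ae hle
      _ = (∫⁻ s in Ioo 0 t, eLpNorm (S s) ∞ volume) * R :=
          lintegral_mul_const _ (FunctionSpaces.measurable_eLpNorm_slice hSm ∞)
      _ < ∞ := ENNReal.mul_lt_top ((lintegral_mono_set htT).trans_lt hS) ENNReal.coe_lt_top
  have hqfst := Measure.quasiMeasurePreserving_fst (μ := νt) (ν := νt)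
  have hqsnd := Measure.quasiMeasurePreserving_snd (μ := νt) (ν := νt)
  -- ### measurability of `Q`
  have hQm : AEStronglyMeasurable (fun p : ℝ × ℝ => Q p.2 p.1) (νt.prod νt) := by
    have h1 := stronglyMeasurable_integral_inner_slice (μ := (volume : Measure E)) hvtm hvtm
    refine h1.aestronglyMeasurable.congr ?_
    filter_upwards [hqfst.ae hvt', hqsnd.ae hvt'] with p hp1 hp2
    rw [hQ]
    refine integral_congr_ae ?_
    filter_upwards [hp1, hp2] with x hx1 hx2
    rw [hx1, hx2]
  -- ### boundedness
  have hN : ∀ s ∈ Icc 0 T, (eLpNorm (v s) 2 volume).toReal ≤ R := fun s hs => by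
    have := ENNReal.toReal_mono ENNReal.coe_ne_top (hR s hs)
    rwa [ENNReal.coe_toReal] at this
  have hR0 : 0 ≤ (R : ℝ) := R.2
  set N₀ : ℝ := (eLpNorm v₀ 2 volume).toReal with hN₀
  have hN₀0 : 0 ≤ N₀ := ENNReal.toReal_nonneg
  set B : ℝ := R * R + N₀ * R with hB
  have hQb : ∀ s ∈ Ioc 0 t, ∀ σ ∈ Ioc 0 t, |Q s σ| ≤ B := by
    intro s hs σ hσ
    rw [hQ]
    refine (abs_integral_inner_le_toReal_eLpNorm_mul (hc.1 s (hIoc s hs)) (hc.1 σ (hIoc σ hσ))).trans ?_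
    have h1 := hN s (hIoc s hs)
    have h2 := hN σ (hIoc σ hσ)
    have h3 : (eLpNorm (v s) 2 volume).toReal * (eLpNorm (v σ) 2 volume).toReal ≤ R * R :=
      mul_le_mul h1 h2 ENNReal.toReal_nonneg hR0
    nlinarith
  -- ### the two representations
  have hrep : ∀ σ, σ ∈ Ioo 0 T → IsWeaklyDivFree (v σ) → ∀ s ∈ Ioc 0 t,
      Q s σ = c σ + ∫ τ in Ioo 0 s, f σ τ := by
    intro σ hσ hdivσ s hs
    have h1 := euler_integral_inner_eq_sub_setIntegral hT hv hc hv₀ hG hGm hS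
      (hc.1 σ (Ioo_subset_Icc_self hσ)) hdivσ (hIoc s hs)
    simp only [hQ, hcdef, hf]
    rw [h1, sub_eq_add_neg, ← integral_neg, setIntegral_congr_set (Ioo_ae_eq_Ioc (α := ℝ))]
  have hfint : ∀ σ ∈ Icc 0 T, IntegrableOn (f σ) (Ioo 0 t) := fun σ hσ => by
    obtain ⟨i1, -⟩ := euler_integrableOn_integral_inner_symGrad_apply hv hc hG hGm hS hR (hc.1 σ hσ)
    rw [hf]; exact (i1.mono_set htT).neg
  have hA' : ∀ᵐ σ ∂νt, IntegrableOn (f σ) (Ioo 0 t) ∧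
      ∀ s ∈ Ioc 0 t, Q s σ = c σ + ∫ τ in Ioo 0 s, f σ τ := by
    filter_upwards [hgood'] with σ hσ
    exact ⟨hfint σ (Ioo_subset_Icc_self hσ.1), hrep σ hσ.1 hσ.2.1⟩
  have hB' : ∀ᵐ s ∂νt, IntegrableOn (f s) (Ioo 0 t) ∧
      ∀ σ ∈ Ioc 0 t, Q s σ = c s + ∫ τ in Ioo 0 σ, f s τ := by
    filter_upwards [hgood'] with s hs
    refine ⟨hfint s (Ioo_subset_Icc_self hs.1), fun σ hσ => ?_⟩
    have hsym : Q s σ = Q σ s := by rw [hQ]; exact integral_inner_comm_aux _ _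
    rw [hsym]; exact hrep s hs.1 hs.2.1 σ hσ
  -- ### continuity of the boundary data
  have hcontR : ∀ {w : E → E}, MemLp w 2 volume →
      ContinuousOn (fun σ => ∫ x, ⟪w x, v σ x⟫) (Icc 0 T) := by
    intro w hw
    exact (hc.continuousOn_integral_inner hw).congr fun σ _ => integral_inner_comm_aux _ _
  have hmemt : MemLp (v t) 2 volume := hc.1 t (hIoc t ⟨ht.1, le_rfl⟩)
  have hQ₁c : ContinuousOn (fun σ => Q t σ) (Icc 0 T) := by rw [hQ]; exact hcontR hmemt
  have hQ₂c : ContinuousOn (fun s => Q s t) (Icc 0 T) := by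
    rw [hQ]; exact hc.continuousOn_integral_inner hmemt
  have hcc : ContinuousOn c (Icc 0 T) := by rw [hcdef]; exact hcontR hv₀
  have hsubIoo : Ioo 0 t ⊆ Icc 0 T := fun x hx => ⟨hx.1.le, hx.2.le.trans ht.2⟩
  have hleft : ∀ {F : ℝ → ℝ}, ContinuousOn F (Icc 0 T) → Tendsto F (𝓝[<] t) (𝓝 (F t)) := by
    intro F hF
    have h1 := hF t (hIoc t ⟨ht.1, le_rfl⟩)
    rw [← nhdsWithin_Ioo_eq_nhdsLT ht.1]
    exact h1.mono_left (nhdsWithin_mono _ hsubIoo)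
  have hright : ∀ {F : ℝ → ℝ}, ContinuousOn F (Icc 0 T) → Tendsto F (𝓝[>] 0) (𝓝 (F 0)) := by
    intro F hF
    exact (hF 0 (left_mem_Icc.2 hT.le)).mono_of_mem_nhdsWithin (Icc_mem_nhdsGT hT)
  have hc0val : c 0 = L₀ := by
    rw [hcdef, hL₀]
    dsimp only
    rw [integral_inner_comm_aux, euler_integral_inner_zero_eq hT hv hc hv₀ hG hGm hS hv₀ hv₀div]
  have hc0 : Tendsto c (𝓝[>] 0) (𝓝 L₀) := hc0val ▸ hright hcc
  have hcb : ∀ σ ∈ Ioo 0 t, |c σ| ≤ B := by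
    intro σ hσ
    rw [hcdef]
    refine (abs_integral_inner_le_toReal_eLpNorm_mul hv₀ (hc.1 σ (hsubIoo hσ))).trans ?_
    have h2 := hN σ (hsubIoo hσ)
    have h3 : N₀ * (eLpNorm (v σ) 2 volume).toReal ≤ N₀ * R := mul_le_mul_of_nonneg_left h2 hN₀0
    nlinarith
  -- ### the kernel-weighted fluxes, through the versions
  have key_int : ∀ n, Integrable (fun p : ℝ × ℝ => (φ n).normed volume (p.2 - p.1) *
      ∫ x, ⟪vt p.2 x, A p.1 x⟫) (νt.prod νt) := fun n =>
    (abs_integral_normed_mul_integral_inner_le (μ := (volume : Measure E)) (φ n) hAm hvtm hA1 hvtR).1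
  have key_int' : ∀ n, Integrable (fun p : ℝ × ℝ => (φ n).normed volume (p.2 - p.1) *
      ∫ x, ⟪vt p.1 x, A p.2 x⟫) (νt.prod νt) := fun n =>
    (integrable_normed_mul_swap_iff (φ n) fun a b => ∫ x, ⟪vt b x, A a x⟫).1 (key_int n)
  set Z : ℝ := ∫ z, ⟪vt z.1 z.2, A z.1 z.2⟫ ∂(νt.prod (volume : Measure E)) with hZdef
  have key_lim : Tendsto (fun n => ∫ p, (φ n).normed volume (p.2 - p.1) *
      (∫ x, ⟪vt p.2 x, A p.1 x⟫) ∂(νt.prod νt)) atTop (𝓝 Z) :=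
    tendsto_integral_normed_mul_integral_inner_of_eLpNorm_le hφ hAm hvtm hA1 hvtR
  have key_lim' : Tendsto (fun n => ∫ p, (φ n).normed volume (p.2 - p.1) *
      (∫ x, ⟪vt p.1 x, A p.2 x⟫) ∂(νt.prod νt)) atTop (𝓝 Z) :=
    tendsto_integral_normed_mul_integral_inner_of_eLpNorm_le_swap hφ hAm hvtm hA1 hvtR
  have hae_f : ∀ᵐ p ∂(νt.prod νt), f p.1 p.2 = -∫ x, ⟪vt p.1 x, A p.2 x⟫ := by
    filter_upwards [hqfst.ae hvt', hqsnd.ae hAt] with p h1 h3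
    rw [hf]
    dsimp only
    rw [integral_inner_comm_aux]
    congr 1
    refine integral_congr_ae ?_
    filter_upwards [h1, h3] with x hx1 hx3
    rw [hx1, hx3]
  have hae_g : ∀ᵐ p ∂(νt.prod νt), f p.2 p.1 = -∫ x, ⟪vt p.2 x, A p.1 x⟫ := by
    filter_upwards [hqsnd.ae hvt', hqfst.ae hAt] with p h1 h3
    rw [hf]
    dsimp only
    rw [integral_inner_comm_aux]
    congr 1
    refine integral_congr_ae ?_
    filter_upwards [h1, h3] with x hx1 hx3
    rw [hx1, hx3]
  have hfF : ∀ n, Integrable (fun p : ℝ × ℝ => (φ n).normed volume (p.2 - p.1) * f p.1 p.2)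
      (νt.prod νt) := fun n => by
    refine ((key_int' n).neg).congr ?_
    filter_upwards [hae_f] with p hp
    simp only [Pi.neg_apply, hp, mul_neg]
  have hgF : ∀ n, Integrable (fun p : ℝ × ℝ => (φ n).normed volume (p.2 - p.1) * f p.2 p.1)
      (νt.prod νt) := fun n => by
    refine ((key_int n).neg).congr ?_
    filter_upwards [hae_g] with p hp
    simp only [Pi.neg_apply, hp, mul_neg]
  have hf_lim : Tendsto (fun n => ∫ p, (φ n).normed volume (p.2 - p.1) * f p.1 p.2 ∂(νt.prod νt))
      atTop (𝓝 (-Z)) := by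
    refine key_lim'.neg.congr fun n => ?_
    rw [← integral_neg]
    refine integral_congr_ae ?_
    filter_upwards [hae_f] with p hp
    rw [hp, mul_neg]
  have hg_lim : Tendsto (fun n => ∫ p, (φ n).normed volume (p.2 - p.1) * f p.2 p.1 ∂(νt.prod νt))
      atTop (𝓝 (-Z)) := by
    refine key_lim.neg.congr fun n => ?_
    rw [← integral_neg]
    refine integral_congr_ae ?_
    filter_upwards [hae_g] with p hp
    rw [hp, mul_neg]
  -- ### the doubling identity
  have hmain := FunctionSpaces.doubling_identity ht.1 hQm hQb hA' hB' (hQ₁c.mono hsubIoo)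
    (hleft hQ₁c) (hQ₂c.mono hsubIoo) (hleft hQ₂c) (hcc.mono hsubIoo) hcb hc0 (hcc.mono hsubIoo)
    hcb hc0 hφ hfF hgF hf_lim hg_lim
  -- ### the bulk vanishes: `Z = ∫₀ᵗ ∫ ⟪v, S v⟫ = 0`
  have hZ : Z = 0 := by
    obtain ⟨iZ, -⟩ := integrable_inner_slab_of_eLpNorm_le (μ := (volume : Measure E)) hAm hvtm hA1 hvtR
    rw [hZdef, integral_prod _ iZ]
    refine integral_eq_zero_of_ae ?_
    filter_upwards [hvt', hAt, hgood'] with s hs hAs hg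
    obtain ⟨hsI, hdivs, hGs, -, haes⟩ := hg
    have h0 := integral_inner_symGrad_apply_self_eq_zero (hc.1 s (Ioo_subset_Icc_self hsI))
      hdivs hGs haes
    calc ∫ x, ⟪vt s x, A s x⟫ = ∫ x, ⟪v s x, S s x (v s x)⟫ :=
          integral_congr_ae (by
            filter_upwards [hs, hAs] with x h1 h2
            rw [h1, h2])
      _ = 0 := by rw [integral_inner_comm_aux]; exact h0
  have hQtt : Q t t = ∫ x, ⟪v t x, v t x⟫ := by rw [hQ]
  rw [← hQtt, hmain, hZ]
  ring

end Energy

end Literature.Analysis.FluidPDE
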